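import Summits.Schanuel.Schanuel.Theorems.SoloInformedAE1tauEventually

/-!
# Theorem AE-2 (η = 0), asymptotic bookkeeping, part A

Soloist file (informed mode, seat `solo-Schanuel-informed`, s180).  Pure real-analysis
bookkeeping, no number theory and no new mathematics: the floors and the first half of the
explicit numerical hypotheses of `soloAG_gelfond_input` (file
`SoloInformedAE2GelfondInput`) hold for all large `n` at the parameters of THEOREM AE-2,

  `x = n^μ`, `K = ⌊n^{σ-μ}⌋`, `t = ⌊n^τ/2⌋ + 1`, `N = ⌊n^{1-μ+δ}⌋`, `Lg = n^{β-μ+δ}`,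
  `V = n^ν/4`, `W = V K/(400 N)`:

`t`-facts for `τ ≥ 0` (`soloAV_tfloor`), `K t ≤ n`, `K n^μ ≤ n^σ`, `3 ≤ n^μ` (`soloAV_Kt`),
the quotients `N/t`, `(N/2 + Lg)/t`, `20(N/t)/K`, `20((N/2+Lg)/t)/K` against powers of `n`
(`soloAV_over`), `W ≥ n^{ν+σ-1-δ}/3200` (`soloAV_W_lower`), and hypotheses `hV`, `h₁`,
`h₂`, `h₃`, `h₄` (`soloAV_condV`, `soloAV_cond1`, `soloAV_cond23`, `soloAV_cond4`).  Each is
a comparison `C · n^a ≤ n^b` with `a < b` (`eventually_const_mul_rpow_le_rpow`) plus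
`log y ≤ y - 1`.  Part B (the budgets `hA`, `hbud`, `h₅`, `h₆` and the Gel'fond comparisons)
is the next file.

References: the seat's `paper/AE-note.md` §9 (THEOREM AE-2); [Roy2010] D. Roy, Small value
estimates for the additive group, Int. J. Number Theory 6 (2010), arXiv:0708.2307.  Tree
files and Mathlib only; no definitions; axioms the standard three.
-/

namespace Summit.Schanuel.Schanuel.Theorems

open Filter

/-- `t = ⌊n^τ/2⌋ + 1` for `τ ≥ 0`: eventually (`n ≥ 1`) `1 ≤ t`, `2(t-1) ≤ n^τ` and
`n^τ/2 ≤ t ≤ n^τ`. -/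
theorem soloAV_tfloor {τ : ℝ} (hτ0 : 0 ≤ τ) :
    ∀ᶠ n : ℕ in atTop, 1 ≤ ⌊(n : ℝ) ^ τ / 2⌋₊ + 1 ∧
      2 * (((⌊(n : ℝ) ^ τ / 2⌋₊ + 1 : ℕ) : ℝ) - 1) ≤ (n : ℝ) ^ τ ∧
      (n : ℝ) ^ τ / 2 ≤ ((⌊(n : ℝ) ^ τ / 2⌋₊ + 1 : ℕ) : ℝ) ∧
      ((⌊(n : ℝ) ^ τ / 2⌋₊ + 1 : ℕ) : ℝ) ≤ (n : ℝ) ^ τ := by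
  filter_upwards [eventually_ge_atTop 1] with n hn
  have hn1 : (1 : ℝ) ≤ n := by exact_mod_cast hn
  have h1 : (1 : ℝ) ≤ (n : ℝ) ^ τ := Real.one_le_rpow hn1 hτ0
  have hpos : 0 ≤ (n : ℝ) ^ τ / 2 := by positivity
  have hfl : ((⌊(n : ℝ) ^ τ / 2⌋₊ : ℕ) : ℝ) ≤ (n : ℝ) ^ τ / 2 := Nat.floor_le hpos
  have hfl' : (n : ℝ) ^ τ / 2 < ((⌊(n : ℝ) ^ τ / 2⌋₊ : ℕ) : ℝ) + 1 := Nat.lt_floor_add_one _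
  refine ⟨by omega, ?_, ?_, ?_⟩
  · push_cast
    linarith
  · push_cast
    linarith
  · push_cast
    by_cases h2 : (n : ℝ) ^ τ < 2
    · have h0 : ⌊(n : ℝ) ^ τ / 2⌋₊ = 0 := Nat.floor_eq_zero.mpr (by linarith)
      rw [h0, Nat.cast_zero, zero_add]
      exact h1
    · linarith

/-- Eventually `K t ≤ n`, `K · n^μ ≤ n^σ` and `3 ≤ n^μ` (`K = ⌊n^{σ-μ}⌋`, `t = ⌊n^τ/2⌋ + 1`,
`0 < μ < σ`, `τ ≥ 0`, `σ + τ < 1`). -/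
theorem soloAV_Kt {σ τ μ : ℝ} (hμ0 : 0 < μ) (hμσ : μ < σ) (hτ0 : 0 ≤ τ) (hστ : σ + τ < 1) :
    ∀ᶠ n : ℕ in atTop, ⌊(n : ℝ) ^ (σ - μ)⌋₊ * (⌊(n : ℝ) ^ τ / 2⌋₊ + 1) ≤ n ∧
      (⌊(n : ℝ) ^ (σ - μ)⌋₊ : ℝ) * (n : ℝ) ^ μ ≤ (n : ℝ) ^ σ ∧ (3 : ℝ) ≤ (n : ℝ) ^ μ := by
  filter_upwards [soloT1_floor (sub_pos.mpr hμσ), soloAV_tfloor hτ0,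
    eventually_const_mul_rpow_le_rpow hμ0 3] with n ⟨hn1, _v1, hKle, _v2⟩ ⟨_v3, _v4, _v5, ht⟩ h3
  rw [Real.rpow_zero, mul_one] at h3
  have hn0 : (0 : ℝ) < n := by linarith
  refine ⟨?_, ?_, h3⟩
  · have h : ((⌊(n : ℝ) ^ (σ - μ)⌋₊ * (⌊(n : ℝ) ^ τ / 2⌋₊ + 1) : ℕ) : ℝ) ≤ n := by
      rw [Nat.cast_mul]
      calc (⌊(n : ℝ) ^ (σ - μ)⌋₊ : ℝ) * ((⌊(n : ℝ) ^ τ / 2⌋₊ + 1 : ℕ) : ℝ)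
          ≤ (n : ℝ) ^ (σ - μ) * (n : ℝ) ^ τ :=
            mul_le_mul hKle ht (by positivity) (by positivity)
        _ = (n : ℝ) ^ (σ - μ + τ) := by rw [Real.rpow_add hn0]
        _ ≤ (n : ℝ) ^ (1 : ℝ) := Real.rpow_le_rpow_of_exponent_le hn1 (by linarith)
        _ = n := Real.rpow_one _
    exact_mod_cast h
  · calc (⌊(n : ℝ) ^ (σ - μ)⌋₊ : ℝ) * (n : ℝ) ^ μ ≤ (n : ℝ) ^ (σ - μ) * (n : ℝ) ^ μ :=
          mul_le_mul_of_nonneg_right hKle (by positivity)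
      _ = (n : ℝ) ^ σ := by
          rw [← Real.rpow_add hn0]
          ring_nf

/-- Quotients at the root-count scale: with `n ≥ 1`, `β ≥ 1`, `t ≥ n^τ/2 > 0`,
`K ≥ n^{σ-μ}/2 > 0`, `N ≤ n^{1-μ+δ}`:  `N/t ≤ 2 n^{1-μ+δ-τ}`,
`(N/2 + n^{β-μ+δ})/t ≤ 3 n^{β-μ+δ-τ}`, `20 (N/t)/K ≤ 80 n^{1-σ-τ+δ}` and
`20 ((N/2 + n^{β-μ+δ})/t)/K ≤ 120 n^{β-σ-τ+δ}`. -/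
theorem soloAV_over {β σ τ μ δ : ℝ} (hβ : 1 ≤ β) {n : ℕ} (hn : (1 : ℝ) ≤ n) {t K N : ℝ}
    (ht0 : 0 < t) (ht : (n : ℝ) ^ τ / 2 ≤ t) (hK0 : 0 < K) (hK : (n : ℝ) ^ (σ - μ) / 2 ≤ K)
    (hN : N ≤ (n : ℝ) ^ (1 - μ + δ)) :
    N / t ≤ 2 * (n : ℝ) ^ (1 - μ + δ - τ) ∧
      (N / 2 + (n : ℝ) ^ (β - μ + δ)) / t ≤ 3 * (n : ℝ) ^ (β - μ + δ - τ) ∧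
      20 * (N / t) / K ≤ 80 * (n : ℝ) ^ (1 - σ - τ + δ) ∧
      20 * ((N / 2 + (n : ℝ) ^ (β - μ + δ)) / t) / K ≤ 120 * (n : ℝ) ^ (β - σ - τ + δ) := by
  have hn0 : (0 : ℝ) < n := by linarith
  have hτpos : 0 < (n : ℝ) ^ τ := by positivity
  have e1 : (n : ℝ) ^ (1 - μ + δ - τ) = (n : ℝ) ^ (1 - μ + δ) / (n : ℝ) ^ τ := by
    rw [Real.rpow_sub hn0]
  have e2 : (n : ℝ) ^ (β - μ + δ - τ) = (n : ℝ) ^ (β - μ + δ) / (n : ℝ) ^ τ := by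
    rw [Real.rpow_sub hn0]
  have hNβ : (n : ℝ) ^ (1 - μ + δ) ≤ (n : ℝ) ^ (β - μ + δ) :=
    Real.rpow_le_rpow_of_exponent_le hn (by linarith)
  have hA : N / t ≤ 2 * (n : ℝ) ^ (1 - μ + δ - τ) := by
    rw [e1, div_le_iff₀ ht0]
    calc N ≤ (n : ℝ) ^ (1 - μ + δ) := hN
      _ = 2 * ((n : ℝ) ^ (1 - μ + δ) / (n : ℝ) ^ τ) * ((n : ℝ) ^ τ / 2) := by
          field_simp
      _ ≤ 2 * ((n : ℝ) ^ (1 - μ + δ) / (n : ℝ) ^ τ) * t :=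
          mul_le_mul_of_nonneg_left ht (by positivity)
  have hB : (N / 2 + (n : ℝ) ^ (β - μ + δ)) / t ≤ 3 * (n : ℝ) ^ (β - μ + δ - τ) := by
    rw [e2, div_le_iff₀ ht0]
    calc N / 2 + (n : ℝ) ^ (β - μ + δ) ≤ 3 / 2 * (n : ℝ) ^ (β - μ + δ) := by linarith
      _ = 3 * ((n : ℝ) ^ (β - μ + δ) / (n : ℝ) ^ τ) * ((n : ℝ) ^ τ / 2) := by
          field_simp
      _ ≤ 3 * ((n : ℝ) ^ (β - μ + δ) / (n : ℝ) ^ τ) * t :=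
          mul_le_mul_of_nonneg_left ht (by positivity)
  have e3 : (n : ℝ) ^ (1 - σ - τ + δ) = (n : ℝ) ^ (1 - μ + δ - τ) / (n : ℝ) ^ (σ - μ) := by
    rw [← Real.rpow_sub hn0]
    congr 1
    ring
  have e4 : (n : ℝ) ^ (β - σ - τ + δ) = (n : ℝ) ^ (β - μ + δ - τ) / (n : ℝ) ^ (σ - μ) := by
    rw [← Real.rpow_sub hn0]
    congr 1
    ring
  have hp1 : 0 ≤ (n : ℝ) ^ (1 - μ + δ - τ) := by positivity
  have hp2 : 0 ≤ (n : ℝ) ^ (β - μ + δ - τ) := by positivity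
  refine ⟨hA, hB, ?_, ?_⟩
  · rw [div_le_iff₀ hK0, e3]
    calc 20 * (N / t) ≤ 20 * (2 * (n : ℝ) ^ (1 - μ + δ - τ)) := by linarith
      _ = 80 * ((n : ℝ) ^ (1 - μ + δ - τ) / (n : ℝ) ^ (σ - μ)) * ((n : ℝ) ^ (σ - μ) / 2) := by
          field_simp
          ring
      _ ≤ 80 * ((n : ℝ) ^ (1 - μ + δ - τ) / (n : ℝ) ^ (σ - μ)) * K :=
          mul_le_mul_of_nonneg_left hK (by positivity)
  · rw [div_le_iff₀ hK0, e4]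
    calc 20 * ((N / 2 + (n : ℝ) ^ (β - μ + δ)) / t)
        ≤ 20 * (3 * (n : ℝ) ^ (β - μ + δ - τ)) := by linarith
      _ = 120 * ((n : ℝ) ^ (β - μ + δ - τ) / (n : ℝ) ^ (σ - μ)) *
            ((n : ℝ) ^ (σ - μ) / 2) := by
          field_simp
          ring
      _ ≤ 120 * ((n : ℝ) ^ (β - μ + δ - τ) / (n : ℝ) ^ (σ - μ)) * K :=
          mul_le_mul_of_nonneg_left hK (by positivity)

/-- `W = (n^ν/4) K/(400 N) ≥ n^{ν+σ-1-δ}/3200` and `W/2 ≥ n^{ν+σ-1-δ}/6400` when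
`K ≥ n^{σ-μ}/2` and `0 < N ≤ n^{1-μ+δ}`. -/
theorem soloAV_W_lower {σ ν μ δ : ℝ} {n : ℕ} (hn : (1 : ℝ) ≤ n) {K N : ℝ}
    (hK : (n : ℝ) ^ (σ - μ) / 2 ≤ K) (hN0 : 0 < N) (hN : N ≤ (n : ℝ) ^ (1 - μ + δ)) :
    (n : ℝ) ^ (ν + σ - 1 - δ) / 3200 ≤ (n : ℝ) ^ ν / 4 * K / (400 * N) ∧
      (n : ℝ) ^ (ν + σ - 1 - δ) / 6400 ≤ (n : ℝ) ^ ν / 4 * K / (400 * N) / 2 := by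
  have hn0 : (0 : ℝ) < n := by linarith
  have hν0 : 0 ≤ (n : ℝ) ^ ν / 4 := by positivity
  have e : (n : ℝ) ^ (ν + σ - 1 - δ) =
      (n : ℝ) ^ ν * (n : ℝ) ^ (σ - μ) / (n : ℝ) ^ (1 - μ + δ) := by
    rw [← Real.rpow_add hn0, ← Real.rpow_sub hn0]
    congr 1
    ring
  have h1 : (n : ℝ) ^ (ν + σ - 1 - δ) / 3200 ≤ (n : ℝ) ^ ν / 4 * K / (400 * N) := by
    calc (n : ℝ) ^ (ν + σ - 1 - δ) / 3200
        = (n : ℝ) ^ ν / 4 * ((n : ℝ) ^ (σ - μ) / 2) / (400 * (n : ℝ) ^ (1 - μ + δ)) := by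
          rw [e]
          ring
      _ ≤ (n : ℝ) ^ ν / 4 * K / (400 * (n : ℝ) ^ (1 - μ + δ)) :=
          div_le_div_of_nonneg_right (mul_le_mul_of_nonneg_left hK hν0) (by positivity)
      _ ≤ (n : ℝ) ^ ν / 4 * K / (400 * N) := by
          have hK0 : 0 ≤ K := le_trans (by positivity) hK
          exact div_le_div_of_nonneg_left (mul_nonneg hν0 hK0) (by positivity) (by linarith)
  exact ⟨h1, by linarith⟩

/-- Hypothesis `hV`: eventually `n^ν/4 ≤ n^ν/2 + n log(min 1 ‖ξ‖)` (`ν > 1`). -/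
theorem soloAV_condV (ξ : ℂ) {ν : ℝ} (hν : 1 < ν) :
    ∀ᶠ n : ℕ in atTop, (n : ℝ) ^ ν / 4 ≤ (n : ℝ) ^ ν / 2 + n * Real.log (min 1 ‖ξ‖) := by
  filter_upwards [eventually_const_mul_rpow_le_rpow hν (-4 * Real.log (min 1 ‖ξ‖))]
    with n h
  rw [Real.rpow_one] at h
  linarith

/-- Hypothesis `h₁`: eventually `2 c₁ N ≤ n^ν/4` (`N = ⌊n^{1-μ+δ}⌋`, `0 < 1 - μ + δ < ν`). -/
theorem soloAV_cond1 {ν μ δ : ℝ} (ha0 : 0 < 1 - μ + δ) (ha : 1 - μ + δ < ν) (c₁ : ℝ) :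
    ∀ᶠ n : ℕ in atTop, 2 * c₁ * ⌊(n : ℝ) ^ (1 - μ + δ)⌋₊ ≤ (n : ℝ) ^ ν / 4 := by
  filter_upwards [soloT1_floor ha0, eventually_const_mul_rpow_le_rpow ha (8 * |c₁|)]
    with n ⟨_v6, _v7, hNle, _v8⟩ h
  have hN0 : (0 : ℝ) ≤ ⌊(n : ℝ) ^ (1 - μ + δ)⌋₊ := Nat.cast_nonneg _
  have h1 : 2 * c₁ * ⌊(n : ℝ) ^ (1 - μ + δ)⌋₊ ≤ 2 * |c₁| * (n : ℝ) ^ (1 - μ + δ) := by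
    calc 2 * c₁ * ⌊(n : ℝ) ^ (1 - μ + δ)⌋₊ ≤ 2 * |c₁| * ⌊(n : ℝ) ^ (1 - μ + δ)⌋₊ :=
          mul_le_mul_of_nonneg_right (by linarith [le_abs_self c₁]) hN0
      _ ≤ 2 * |c₁| * (n : ℝ) ^ (1 - μ + δ) := mul_le_mul_of_nonneg_left hNle (by positivity)
  linarith

/-- Hypotheses `h₂`, `h₃`: eventually `exp(-W) ≤ 1/2` and `4 exp(-W) ≤ ‖ξ‖`,
`W = (n^ν/4) K/(400 N)` (`0 < ν + σ - 1 - δ`). -/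
theorem soloAV_cond23 {ξ : ℂ} (hξ0 : ξ ≠ 0) {σ ν μ δ : ℝ} (hμσ : μ < σ)
    (ha0 : 0 < 1 - μ + δ) (hg : 0 < ν + σ - 1 - δ) :
    ∀ᶠ n : ℕ in atTop,
      Real.exp (-((n : ℝ) ^ ν / 4 * ⌊(n : ℝ) ^ (σ - μ)⌋₊ /
          (400 * ⌊(n : ℝ) ^ (1 - μ + δ)⌋₊))) ≤ 1 / 2 ∧
        4 * Real.exp (-((n : ℝ) ^ ν / 4 * ⌊(n : ℝ) ^ (σ - μ)⌋₊ /
          (400 * ⌊(n : ℝ) ^ (1 - μ + δ)⌋₊))) ≤ ‖ξ‖ := by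
  have hξpos : 0 < ‖ξ‖ := norm_pos_iff.mpr hξ0
  have hl2 : 0 < Real.log 2 := Real.log_pos one_lt_two
  filter_upwards [soloT1_floor (sub_pos.mpr hμσ), soloT1_floor ha0,
    eventually_const_mul_rpow_le_rpow hg (3200 * (Real.log 2 + |Real.log (4 / ‖ξ‖)|))]
    with n ⟨hn1, _v9, _v10, hKge⟩ ⟨_v11, hN1, hNle, _v12⟩ h
  rw [Real.rpow_zero, mul_one] at h
  have hN0 : (0 : ℝ) < ⌊(n : ℝ) ^ (1 - μ + δ)⌋₊ := by
    exact_mod_cast (show 0 < ⌊(n : ℝ) ^ (1 - μ + δ)⌋₊ by omega)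
  obtain ⟨hW, -⟩ := soloAV_W_lower (ν := ν) hn1 hKge hN0 hNle
  set W := (n : ℝ) ^ ν / 4 * ⌊(n : ℝ) ^ (σ - μ)⌋₊ / (400 * ⌊(n : ℝ) ^ (1 - μ + δ)⌋₊)
    with hWdef
  have hW2 : Real.log 2 + |Real.log (4 / ‖ξ‖)| ≤ W := by linarith
  have habs := le_abs_self (Real.log (4 / ‖ξ‖))
  have habs0 := abs_nonneg (Real.log (4 / ‖ξ‖))
  constructor
  · calc Real.exp (-W) ≤ Real.exp (-Real.log 2) := Real.exp_le_exp.mpr (by linarith)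
      _ = 1 / 2 := by rw [Real.exp_neg, Real.exp_log two_pos, one_div]
  · have h4 : Real.exp (-W) ≤ ‖ξ‖ / 4 := by
      calc Real.exp (-W) ≤ Real.exp (-Real.log (4 / ‖ξ‖)) :=
            Real.exp_le_exp.mpr (by linarith)
        _ = ‖ξ‖ / 4 := by rw [Real.exp_neg, Real.exp_log (by positivity), inv_div]
    linarith

/-- Hypothesis `h₄`: eventually `log(8(K‖ξ‖ + 1)) ≤ W/2 = (n^ν/4) K/(800 N)`
(`σ - μ < ν + σ - 1 - δ`, `0 < ν + σ - 1 - δ`). -/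
theorem soloAV_cond4 (ξ : ℂ) {σ ν μ δ : ℝ} (hμσ : μ < σ) (ha0 : 0 < 1 - μ + δ)
    (hg : 0 < ν + σ - 1 - δ) (hg' : σ - μ < ν + σ - 1 - δ) :
    ∀ᶠ n : ℕ in atTop, Real.log (8 * (⌊(n : ℝ) ^ (σ - μ)⌋₊ * ‖ξ‖ + 1)) ≤
      (n : ℝ) ^ ν / 4 * ⌊(n : ℝ) ^ (σ - μ)⌋₊ / (800 * ⌊(n : ℝ) ^ (1 - μ + δ)⌋₊) := by
  filter_upwards [soloT1_floor (sub_pos.mpr hμσ), soloT1_floor ha0,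
    eventually_const_mul_rpow_le_rpow hg (12800 * 8),
    eventually_const_mul_rpow_le_rpow hg' (12800 * (8 * ‖ξ‖))]
    with n ⟨hn1, _v13, hKle, hKge⟩ ⟨_v14, hN1, hNle, _v15⟩ ha hb
  rw [Real.rpow_zero, mul_one] at ha
  have hN0 : (0 : ℝ) < ⌊(n : ℝ) ^ (1 - μ + δ)⌋₊ := by
    exact_mod_cast (show 0 < ⌊(n : ℝ) ^ (1 - μ + δ)⌋₊ by omega)
  obtain ⟨-, hW⟩ := soloAV_W_lower (ν := ν) hn1 hKge hN0 hNle
  have e : (n : ℝ) ^ ν / 4 * ⌊(n : ℝ) ^ (σ - μ)⌋₊ / (800 * ⌊(n : ℝ) ^ (1 - μ + δ)⌋₊) =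
      (n : ℝ) ^ ν / 4 * ⌊(n : ℝ) ^ (σ - μ)⌋₊ / (400 * ⌊(n : ℝ) ^ (1 - μ + δ)⌋₊) / 2 := by
    ring
  have hK0 : (0 : ℝ) ≤ ⌊(n : ℝ) ^ (σ - μ)⌋₊ := Nat.cast_nonneg _
  have hξ0 : 0 ≤ ‖ξ‖ := norm_nonneg ξ
  have hlog : Real.log (8 * (⌊(n : ℝ) ^ (σ - μ)⌋₊ * ‖ξ‖ + 1)) ≤
      8 * (⌊(n : ℝ) ^ (σ - μ)⌋₊ * ‖ξ‖ + 1) := by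
    have := Real.log_le_sub_one_of_pos
      (by positivity : 0 < 8 * ((⌊(n : ℝ) ^ (σ - μ)⌋₊ : ℝ) * ‖ξ‖ + 1))
    linarith
  have hKξ : (⌊(n : ℝ) ^ (σ - μ)⌋₊ : ℝ) * ‖ξ‖ ≤ (n : ℝ) ^ (σ - μ) * ‖ξ‖ :=
    mul_le_mul_of_nonneg_right hKle hξ0
  rw [e]
  linarith

end Summit.Schanuel.Schanuel.Theorems
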